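import Summits.Ventures.PercRepro.C041TriDomExcessMinorStar

/-!
# ROW C-041 — THE EQUALITY CASE OF THE EXCESS, VIII: THE THEOREMS `e ≥ 1` FOR TRIANGLE AND STAR MINORS
(p6, gen 43; §53 ADDENDUM 2)

On parts VI–VII.  THE COUNT for any pattern function with a non-negative contribution equal to `1` at all-red and
all-blue (`esym_ge_two_mul_fiber`), THE DELETION–CONTRACTION CHAIN (`esym_setStatus_le`: the non-free edges of a
three-free status are absent or double and each costs a factor `≤ 2` by `esym_absent_le` / `esym_double_le`), the
distinctness of the three edges of a minor (`TriMinor.ne₁₂` …), and the THEOREMS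
**`excess_ge_one_of_triMinor`** / **`excess_ge_one_of_starMinor`**: a host admitting a status that is a triangle
minor or a star minor on its marks has `N_RRa ≥ N_RB + N_WRj + N_RWj + 1`.  Every host with a cycle or a tripod
through its marks admits one (contract all but one edge on each arc or leg, delete the rest) — that step, and the
Menger-type alternative «connected and non-separable ⟹ cycle or tripod», stay paper (ADDENDUM 2).
-/

namespace PercRepro

namespace ZoneZ

namespace MultiExit

open ZoneData Finset

variable {V₁ E₁ U₁ U₂ : Type} (Z₁ : ZoneData V₁ E₁ U₁ U₂) (u u' a₁ : V₁)

variable [DecidableEq E₁] [Fintype E₁]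

/-! ## The count for a pattern function -/

open Classical in
/-- If the patterns of `st` are `pat` of the colours of `f₁, f₂, f₃` (red) and of their negations (blue), and the
resulting contribution `G` is non-negative with `G = 1` at all-red and all-blue, then `esym st ≥ 2 · #fibre`. -/
theorem esym_ge_two_mul_fiber (st : E₁ → EStat) {f₁ f₂ f₃ : E₁} (h12 : f₁ ≠ f₂) (h13 : f₁ ≠ f₃) (h23 : f₂ ≠ f₃)
    (pat : Bool → Bool → Bool → P3)
    (hr : ∀ ω : E₁ → Bool, rsig Z₁ u u' a₁ st ω = pat (ω f₁) (ω f₂) (ω f₃))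
    (hb : ∀ ω : E₁ → Bool, bsig Z₁ u u' a₁ st ω = pat (!ω f₁) (!ω f₂) (!ω f₃))
    (hG0 : ∀ b : Bool × Bool × Bool, 0 ≤ Fsym (pat b.1 b.2.1 b.2.2) (pat (!b.1) (!b.2.1) (!b.2.2)))
    (hGt : Fsym (pat true true true) (pat false false false) = 1)
    (hGf : Fsym (pat false false false) (pat true true true) = 1) :
    2 * ((univ.filter fun ω : E₁ → Bool => bits f₁ f₂ f₃ ω = (true, true, true)).card : ℤ) ≤
      esym Z₁ u u' a₁ st := by
  unfold esym
  have hlow : ∀ ω : E₁ → Bool,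
      ((if bits f₁ f₂ f₃ ω = (true, true, true) then 1 else 0)
        + (if bits f₁ f₂ f₃ ω = (false, false, false) then 1 else 0) : ℤ)
        ≤ Fsym (rsig Z₁ u u' a₁ st ω) (bsig Z₁ u u' a₁ st ω) := by
    intro ω
    rw [hr ω, hb ω]
    by_cases ht : bits f₁ f₂ f₃ ω = (true, true, true)
    · have h1 : ω f₁ = true := congrArg Prod.fst ht
      have h2 : ω f₂ = true := congrArg (fun p => p.2.1) ht
      have h3 : ω f₃ = true := congrArg (fun p => p.2.2) ht
      rw [if_pos ht, h1, h2, h3]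
      have hf : bits f₁ f₂ f₃ ω ≠ (false, false, false) := by rw [ht]; decide
      rw [if_neg hf]; simp [hGt]
    · by_cases hf : bits f₁ f₂ f₃ ω = (false, false, false)
      · have h1 : ω f₁ = false := congrArg Prod.fst hf
        have h2 : ω f₂ = false := congrArg (fun p => p.2.1) hf
        have h3 : ω f₃ = false := congrArg (fun p => p.2.2) hf
        rw [if_pos hf, if_neg ht, h1, h2, h3]; simp [hGf]
      · rw [if_neg ht, if_neg hf]
        simpa using hG0 (ω f₁, ω f₂, ω f₃)
  refine le_trans ?_ (Finset.sum_le_sum fun ω _ => hlow ω)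
  rw [Finset.sum_add_distrib, Finset.sum_boole, Finset.sum_boole,
    card_fiber_eq h12 h13 h23 (false, false, false)]
  linarith

/-! ## The deletion–contraction chain -/

/-- The status with the edges of `X` given the statuses of `σ`. -/
def setStatus (st σ : E₁ → EStat) (X : Finset E₁) : E₁ → EStat := fun e => if e ∈ X then σ e else st e

/-- Deleting or contracting the edges of `X` (free in `st`, non-free in `σ`) one at a time multiplies the
normalised excess by at most `2^#X`. -/
theorem esym_setStatus_le (st σ : E₁ → EStat) (X : Finset E₁) (hX : ∀ e ∈ X, st e = .free)
    (hσ : ∀ e ∈ X, σ e ≠ .free) :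
    esym Z₁ u u' a₁ (setStatus st σ X) ≤ 2 ^ X.card * esym Z₁ u u' a₁ st := by
  induction X using Finset.induction_on with
  | empty =>
    have : setStatus st σ ∅ = st := by funext e; simp [setStatus]
    rw [this]; simp
  | @insert f X hf ih =>
    have hup : setStatus st σ (insert f X) = Function.update (setStatus st σ X) f (σ f) := by
      funext e
      by_cases he : e = f
      · subst he; simp [setStatus]
      · simp [setStatus, he]
    have hfree : setStatus st σ X f = .free := by
      simp [setStatus, hf, hX f (Finset.mem_insert_self f X)]
    have h2 := ih (fun e he => hX e (Finset.mem_insert_of_mem he)) (fun e he => hσ e (Finset.mem_insert_of_mem he))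
    have h0 := esym_nonneg Z₁ u u' a₁ st
    have hσf := hσ f (Finset.mem_insert_self f X)
    rw [hup, Finset.card_insert_of_notMem hf, pow_succ]
    cases hs : σ f with
    | free => exact absurd hs hσf
    | absent =>
      have h1 := esym_absent_le Z₁ u u' a₁ (setStatus st σ X) f hfree
      nlinarith
    | double =>
      have h1 := esym_double_le Z₁ u u' a₁ (setStatus st σ X) f hfree
      nlinarith

/-- A three-free status is the all-free status with the other edges re-assigned. -/
theorem threeFree_eq_setStatus {st : E₁ → EStat} {f₁ f₂ f₃ : E₁} (h : ThreeFree st f₁ f₂ f₃) :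
    st = setStatus (fun _ => EStat.free) st (univ.filter fun e => ¬ (e = f₁ ∨ e = f₂ ∨ e = f₃)) := by
  funext e
  unfold setStatus
  simp only [Finset.mem_filter, Finset.mem_univ, true_and]
  by_cases he : e = f₁ ∨ e = f₂ ∨ e = f₃
  · rw [if_neg (not_not.mpr he)]
    rcases he with rfl | rfl | rfl
    · exact h.1
    · exact h.2.1
    · exact h.2.2.1
  · rw [if_pos he]

/-! ## The theorems -/

omit [DecidableEq E₁] [Fintype E₁] in
/-- The three edges of a triangle minor are distinct. -/
theorem TriMinor.ne {st : E₁ → EStat} {f₁ f₂ f₃ : E₁} (h : TriMinor Z₁ u u' a₁ st f₁ f₂ f₃) :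
    f₁ ≠ f₂ ∧ f₁ ≠ f₃ ∧ f₂ ≠ f₃ := by
  obtain ⟨x₁, y₁, hj1, hx1, hy1⟩ := h.j1
  obtain ⟨x₂, y₂, hj2, hx2, hy2⟩ := h.j2
  obtain ⟨x₃, y₃, hj3, hx3, hy3⟩ := h.j3
  refine ⟨?_, ?_, ?_⟩
  · rintro rfl
    rcases joins_unique hj1 hj2 with ⟨rfl, rfl⟩ | ⟨rfl, rfl⟩
    · exact h.nuu' (DConn_trans Z₁ hy1 (DConn_symm Z₁ hy2))
    · exact h.nau' (DConn_trans Z₁ hx1 (DConn_symm Z₁ hy2))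
  · rintro rfl
    rcases joins_unique hj1 hj3 with ⟨rfl, rfl⟩ | ⟨rfl, rfl⟩
    · exact h.nau (DConn_trans Z₁ hx1 (DConn_symm Z₁ hx3))
    · exact h.nau' (DConn_trans Z₁ hx1 (DConn_symm Z₁ hy3))
  · rintro rfl
    rcases joins_unique hj2 hj3 with ⟨rfl, rfl⟩ | ⟨rfl, rfl⟩
    · exact h.nau (DConn_trans Z₁ hx2 (DConn_symm Z₁ hx3))
    · exact h.nau' (DConn_trans Z₁ hx2 (DConn_symm Z₁ hy3))

omit [DecidableEq E₁] [Fintype E₁] in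
/-- The three spokes of a star minor are distinct. -/
theorem StarMinor.ne {st : E₁ → EStat} {c : V₁} {f₁ f₂ f₃ : E₁} (h : StarMinor Z₁ u u' a₁ st c f₁ f₂ f₃) :
    f₁ ≠ f₂ ∧ f₁ ≠ f₃ ∧ f₂ ≠ f₃ := by
  obtain ⟨x₁, y₁, hj1, hx1, hy1⟩ := h.j1
  obtain ⟨x₂, y₂, hj2, hx2, hy2⟩ := h.j2
  obtain ⟨x₃, y₃, hj3, hx3, hy3⟩ := h.j3
  refine ⟨?_, ?_, ?_⟩
  · rintro rfl
    rcases joins_unique hj1 hj2 with ⟨rfl, rfl⟩ | ⟨rfl, rfl⟩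
    · exact h.nau (DConn_trans Z₁ hy1 (DConn_symm Z₁ hy2))
    · exact h.ncu (DConn_trans Z₁ hx1 (DConn_symm Z₁ hy2))
  · rintro rfl
    rcases joins_unique hj1 hj3 with ⟨rfl, rfl⟩ | ⟨rfl, rfl⟩
    · exact h.nau' (DConn_trans Z₁ hy1 (DConn_symm Z₁ hy3))
    · exact h.ncu' (DConn_trans Z₁ hx1 (DConn_symm Z₁ hy3))
  · rintro rfl
    rcases joins_unique hj2 hj3 with ⟨rfl, rfl⟩ | ⟨rfl, rfl⟩
    · exact h.nuu' (DConn_trans Z₁ hy2 (DConn_symm Z₁ hy3))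
    · exact h.ncu' (DConn_trans Z₁ hx2 (DConn_symm Z₁ hy3))

open Classical in
/-- From the fibre bound and the chain to the all-free excess. -/
theorem excess_ge_one_of_bounds {st : E₁ → EStat} {f₁ f₂ f₃ : E₁} (h3 : ThreeFree st f₁ f₂ f₃)
    (h12 : f₁ ≠ f₂) (h13 : f₁ ≠ f₃) (h23 : f₂ ≠ f₃)
    (hfib : 2 * ((univ.filter fun ω : E₁ → Bool => bits f₁ f₂ f₃ ω = (true, true, true)).card : ℤ) ≤
      esym Z₁ u u' a₁ st) : 1 ≤ excess Z₁ u u' a₁ := by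
  have hcard := eight_mul_card_fiber (E₁ := E₁) h12 h13 h23
  have hdel := esym_setStatus_le Z₁ u u' a₁ (fun _ => EStat.free) st
    (univ.filter fun e => ¬ (e = f₁ ∨ e = f₂ ∨ e = f₃)) (fun _ _ => rfl)
    (fun e he => by
      simp only [Finset.mem_filter, Finset.mem_univ, true_and, not_or] at he
      exact h3.2.2.2 e he.1 he.2.1 he.2.2)
  rw [← threeFree_eq_setStatus h3] at hdel
  have hk := card_others (E₁ := E₁) h12 h13 h23
  have hpow : (2 : ℕ) ^ Fintype.card E₁ =
      2 ^ (univ.filter fun e : E₁ => ¬ (e = f₁ ∨ e = f₂ ∨ e = f₃)).card * 8 := by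
    rw [← hk, pow_add]; norm_num
  have hN8 : ((univ.filter fun ω : E₁ → Bool => bits f₁ f₂ f₃ ω = (true, true, true)).card : ℤ) =
      2 ^ (univ.filter fun e : E₁ => ¬ (e = f₁ ∨ e = f₂ ∨ e = f₃)).card := by
    have h8 := hcard.trans hpow
    have : (8 * (univ.filter fun ω : E₁ → Bool => bits f₁ f₂ f₃ ω = (true, true, true)).card : ℤ) =
        2 ^ (univ.filter fun e : E₁ => ¬ (e = f₁ ∨ e = f₂ ∨ e = f₃)).card * 8 := by exact_mod_cast h8
    linarith
  have hpos : (0 : ℤ) < 2 ^ (univ.filter fun e : E₁ => ¬ (e = f₁ ∨ e = f₂ ∨ e = f₃)).card := by positivity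
  have h2 : (2 : ℤ) ^ (univ.filter fun e : E₁ => ¬ (e = f₁ ∨ e = f₂ ∨ e = f₃)).card * 2 ≤
      2 ^ (univ.filter fun e : E₁ => ¬ (e = f₁ ∨ e = f₂ ∨ e = f₃)).card * esym Z₁ u u' a₁ (fun _ => EStat.free) := by
    have := hfib.trans hdel
    rw [hN8] at this
    linarith
  have hE : 2 ≤ esym Z₁ u u' a₁ (fun _ => EStat.free) := le_of_mul_le_mul_left h2 hpos
  rw [excess_eq_excessZ Z₁ u u' a₁]
  rw [esym_free_eq Z₁ u u' a₁] at hE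
  have : (1 : ℤ) ≤ excessZ Z₁ u u' a₁ := by omega
  exact_mod_cast this

open Classical in
/-- **THEOREM (A TRIANGLE MINOR ON THE MARKS FORCES `e ≥ 1`)**: a host admitting a status that is a triangle minor
on its marks — a cycle through the marks, contracted — has `N_RRa ≥ N_RB + N_WRj + N_RWj + 1`. -/
theorem excess_ge_one_of_triMinor {st : E₁ → EStat} {f₁ f₂ f₃ : E₁} (h : TriMinor Z₁ u u' a₁ st f₁ f₂ f₃) :
    1 ≤ excess Z₁ u u' a₁ := by
  obtain ⟨h12, h13, h23⟩ := h.ne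
  refine excess_ge_one_of_bounds Z₁ u u' a₁ h.three h12 h13 h23 ?_
  exact esym_ge_two_mul_fiber Z₁ u u' a₁ st h12 h13 h23 triPat (rsig_triMinor Z₁ u u' a₁ h)
    (bsig_triMinor Z₁ u u' a₁ h) triG_nonneg triG_ttt triG_fff

open Classical in
/-- **THEOREM (A STAR MINOR ON THE MARKS FORCES `e ≥ 1`)**: a host admitting a status that is a star minor on its
marks — a tripod through the marks, contracted — has `N_RRa ≥ N_RB + N_WRj + N_RWj + 1`. -/
theorem excess_ge_one_of_starMinor {st : E₁ → EStat} {c : V₁} {f₁ f₂ f₃ : E₁}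
    (h : StarMinor Z₁ u u' a₁ st c f₁ f₂ f₃) : 1 ≤ excess Z₁ u u' a₁ := by
  obtain ⟨h12, h13, h23⟩ := h.ne
  refine excess_ge_one_of_bounds Z₁ u u' a₁ h.three h12 h13 h23 ?_
  exact esym_ge_two_mul_fiber Z₁ u u' a₁ st h12 h13 h23 starPat (rsig_starMinor Z₁ u u' a₁ h)
    (bsig_starMinor Z₁ u u' a₁ h) starG_nonneg starG_ttt starG_fff

/-! ## A tripod of single edges -/

omit [DecidableEq E₁] [Fintype E₁] in
/-- Without double edges, double connectivity is equality. -/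
theorem DConn_iff_eq_of_no_dbl {st : E₁ → EStat} (hst : ∀ e, st e ≠ .double) (k v : V₁) :
    DConn Z₁ st k v ↔ k = v := by
  constructor
  · intro h
    unfold DConn at h
    rw [mem_reach_singleton] at h
    induction h with
    | refl => rfl
    | tail _ hxy _ =>
      obtain ⟨e, _, hd⟩ := hxy
      exact absurd hd (hst e)
  · rintro rfl
    exact DConn_refl Z₁ st k

omit [Fintype E₁] in
/-- The triangle status has no double edges. -/
theorem triSt_ne_double (f₁ f₂ f₃ : E₁) (e : E₁) : triSt f₁ f₂ f₃ e ≠ .double := by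
  unfold triSt
  by_cases h : e = f₁ ∨ e = f₂ ∨ e = f₃ <;> simp [h]

omit [Fintype E₁] in
/-- The triangle status is three-free. -/
theorem threeFree_triSt (f₁ f₂ f₃ : E₁) : ThreeFree (triSt f₁ f₂ f₃) f₁ f₂ f₃ := by
  refine ⟨?_, ?_, ?_, fun e h1 h2 h3 => ?_⟩
  · simp [triSt]
  · simp [triSt]
  · simp [triSt]
  · simp [triSt, h1, h2, h3]

omit [Fintype E₁] in
/-- A tripod of single edges (a vertex `c` off the marks joined to each of them) is a star minor. -/
theorem starMinor_of_tripod {c : V₁} {f₁ f₂ f₃ : E₁} (hca : c ≠ a₁) (hcu : c ≠ u) (hcu' : c ≠ u')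
    (hau : a₁ ≠ u) (hau' : a₁ ≠ u') (huu' : u ≠ u') (h1 : Z₁.Joins f₁ c a₁) (h2 : Z₁.Joins f₂ c u)
    (h3 : Z₁.Joins f₃ c u') : StarMinor Z₁ u u' a₁ (triSt f₁ f₂ f₃) c f₁ f₂ f₃ where
  three := threeFree_triSt f₁ f₂ f₃
  nca := fun h => hca ((DConn_iff_eq_of_no_dbl Z₁ (triSt_ne_double f₁ f₂ f₃) _ _).1 h)
  ncu := fun h => hcu ((DConn_iff_eq_of_no_dbl Z₁ (triSt_ne_double f₁ f₂ f₃) _ _).1 h)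
  ncu' := fun h => hcu' ((DConn_iff_eq_of_no_dbl Z₁ (triSt_ne_double f₁ f₂ f₃) _ _).1 h)
  nau := fun h => hau ((DConn_iff_eq_of_no_dbl Z₁ (triSt_ne_double f₁ f₂ f₃) _ _).1 h)
  nau' := fun h => hau' ((DConn_iff_eq_of_no_dbl Z₁ (triSt_ne_double f₁ f₂ f₃) _ _).1 h)
  nuu' := fun h => huu' ((DConn_iff_eq_of_no_dbl Z₁ (triSt_ne_double f₁ f₂ f₃) _ _).1 h)
  j1 := ⟨c, a₁, h1, DConn_refl Z₁ _ c, DConn_refl Z₁ _ a₁⟩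
  j2 := ⟨c, u, h2, DConn_refl Z₁ _ c, DConn_refl Z₁ _ u⟩
  j3 := ⟨c, u', h3, DConn_refl Z₁ _ c, DConn_refl Z₁ _ u'⟩

open Classical in
/-- **THEOREM (A TRIPOD ON THE MARKS FORCES `e ≥ 1`)**: a vertex off the three distinct marks joined to each of
them by an edge gives `N_RRa ≥ N_RB + N_WRj + N_RWj + 1`. -/
theorem excess_ge_one_of_tripod {c : V₁} {f₁ f₂ f₃ : E₁} (hca : c ≠ a₁) (hcu : c ≠ u) (hcu' : c ≠ u')
    (hau : a₁ ≠ u) (hau' : a₁ ≠ u') (huu' : u ≠ u') (h1 : Z₁.Joins f₁ c a₁) (h2 : Z₁.Joins f₂ c u)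
    (h3 : Z₁.Joins f₃ c u') : 1 ≤ excess Z₁ u u' a₁ :=
  excess_ge_one_of_starMinor Z₁ u u' a₁ (starMinor_of_tripod Z₁ u u' a₁ hca hcu hcu' hau hau' huu' h1 h2 h3)

end MultiExit

end ZoneZ

end PercRepro
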